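import Summits.PneNP.PneNP.Theses.SymmetryBudget
import Summits.PneNP.PneNP.Theorems.NPNotSubsetPPoly
import Literature.Computability.Complexity.SymmetricCircuit
import Literature.Computability.Complexity.ClayProblemProofs
import Literature.Computability.Complexity.CircuitClassesUniformProofs

/-!
# `NP ⊆ P → NP ⊆ P/poly`, and the P/poly form of `HamCompiles`

Negative lemmas for crux `stmt-PneNP-10637` (`HamCompiles`, route `PneNP/SymmetryBudget`;
cdisprove seat `refuter-cdisprove-stmt-PneNP-10637-g2-0`, cycle 2; work file
`Cruxes/HamCompiles/Disproof.lean` §11).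

* `np_subset_ppoly_of_np_subset_p`: Cook's hypothesis of the crux, `PNPWave0.NP Bool ⊆ PNPWave0.P
  Bool`, gives `Nondeterministic.NP ⊆ PPoly` through the PROVED tree facts `NP_bool_eq_holds`,
  `P_bool_eq_holds` (model bridges) and `P_subset_PPoly_holds` (Arora–Barak Thm 6.6); so it denies
  the conjecture leaf `NPNotSubsetPPoly` (`not_npNotSubsetPPoly_of_np_subset_p`).
* `not_ppolyForm_of_not_hamCompiles`: consequently the P/poly form
  `NP ⊆ P/poly → ∃ p ∀ m, HasSymCircuit tcBasis (Bud m ⌊log₂ m⌋) (p m) HAM_m` — the form that every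
  proposed compilation line for the crux actually proves (one NP query on Bud-invariant wires,
  answered by an advice circuit) — is STRONGER than the crux: a refutation of the crux refutes it.
  Its logical content, `PPolyForm ↔ (WindowHam → NPNotSubsetPPoly)`, is `ppolyForm_iff` in
  `Negative/BudgetScale.lean`.
-/

-- `Summit.PneNP.PneNP.…` duplicates `PneNP` BY DESIGN (single-problem summit, D-0017); the Summits
-- library sets this option globally (lakefile), repeated here so a standalone `lean check` is warning-free.
set_option linter.dupNamespace false

namespace Summit.PneNP.PneNP.Theorems.HamCompiles.Negative

open Literature.Computability.Complexity
open Summit.PneNP.PneNP.Theses.SymmetryBudget (HamCompiles)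
open scoped Classical

/-- `NP ⊆ P → NP ⊆ P/poly` (Cook's classes to Mathlib-TM2 classes through the PROVED model bridges
`NP_bool_eq_holds`, `P_bool_eq_holds`, then `P_subset_PPoly_holds`). -/
theorem np_subset_ppoly_of_np_subset_p (h : PNPWave0.NP Bool ⊆ PNPWave0.P Bool) :
    Nondeterministic.NP ⊆ PPoly := by
  intro L hL
  have hNP : L ∈ PNPWave0.NP Bool := by
    rw [show PNPWave0.NP Bool = Nondeterministic.NP from NP_bool_eq_holds]; exact hL
  have hP : L ∈ PNPWave0.P Bool := h hNP
  rw [show PNPWave0.P Bool = Classes.P from P_bool_eq_holds] at hP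
  exact P_subset_PPoly_holds hP

/-- Hence `NP ⊆ P` denies the conjecture leaf `NPNotSubsetPPoly`. -/
theorem not_npNotSubsetPPoly_of_np_subset_p (h : PNPWave0.NP Bool ⊆ PNPWave0.P Bool) :
    ¬ NPNotSubsetPPoly := fun hN => hN (np_subset_ppoly_of_np_subset_p h)

/-- **A refutation of the crux refutes the P/poly form** `NP ⊆ P/poly → ConclAt ⌊log₂⌋` that
every proposed compilation line establishes (the form is STRONGER than the crux). -/
theorem not_ppolyForm_of_not_hamCompiles (hc : ¬ HamCompiles) :
    ¬ ((Nondeterministic.NP ⊆ PPoly) →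
        (∃ p : Polynomial ℕ, ∀ m : ℕ,
      HasSymCircuit tcBasis (pointStabiliserBudget m (Nat.log 2 m)) (p.eval m)
        (fun x : Fin m × Fin m → Bool =>
          decide (SimpleGraph.fromRel fun u v => x (u, v) = true : SimpleGraph (Fin m)).IsHamiltonian))) := by
  have hc' : (PNPWave0.NP Bool ⊆ PNPWave0.P Bool) ∧
      ¬ (∃ p : Polynomial ℕ, ∀ m : ℕ,
      HasSymCircuit tcBasis (pointStabiliserBudget m (Nat.log 2 m)) (p.eval m)
        (fun x : Fin m × Fin m → Bool =>
          decide (SimpleGraph.fromRel fun u v => x (u, v) = true : SimpleGraph (Fin m)).IsHamiltonian)) :=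
    Classical.not_imp.1 hc
  exact Classical.not_imp.2 ⟨np_subset_ppoly_of_np_subset_p hc'.1, hc'.2⟩

end Summit.PneNP.PneNP.Theorems.HamCompiles.Negative
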